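import Mathlib
import Summits.NavierStokesRegularity.NavierStokesRegularity.Theses.FilamentSkeletonRss
import Summits.NavierStokesRegularity.NavierStokesRegularity.Theorems.FilamentSkeletonRssCoreGluingClassicalOfProfile
import Summits.NavierStokesRegularity.NavierStokesRegularity.Theorems.FilamentSkeletonRssCoreGluingRssPackaging

/-!
# Route FilamentSkeletonRss · crux `CoreGluing` (stmt-NavierStokesRegularity-15401) — the reduction to the profile system

Composition of the two landed bookkeeping stubs of line `Sketch` (`stub_classicalOfProfile`,
`stub_rssPackaging`): the route target `RssProfileExists` — hence the crux `CoreGluing` — follows from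
the existence of ONE smooth nontrivial solution `(U, P)` of Perelman's rotated Leray profile system
(Pineau–Vicol 2026, (1.8)) `α(JU − DU[Jy]) + ½U + ½DU[y] − ΔU + DU[U] + ∇P = 0`, `∇·U = 0`, `α ≠ 0`,
with the profile Type-I decay `‖U y‖ ≤ C₀/(1+‖y‖)` and a bounded pressure. This records, as a tree
theorem, that the crux as typed is exactly "produce such a profile" plus bookkeeping (the lead's
skeleton `CoreGluing_of` = `stub_rssProfileFromSkeleton` followed by this reduction).
-/

set_option linter.dupNamespace false

noncomputable section

namespace Summit.NavierStokesRegularity.NavierStokesRegularity.Theorems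

open Set Function Filter MeasureTheory
open Literature.Analysis.FluidPDE Literature.Analysis.FluidPDE.PineauVicol2026
open scoped RealInnerProductSpace Laplacian ContDiff Topology

/-- **A smooth decaying solution of the rotated profile system gives `RssProfileExists`** (and hence
`CoreGluing`): composition of `stub_classicalOfProfile` (profile ⇒ classical Navier–Stokes solution
`pvAnsatz α U` on `(−∞,0)` with pressure bounded on past slabs) and `stub_rssPackaging` (classical
rotated-self-similar Type-I solution ⇒ the route target). Registered tool stub of crux
stmt-NavierStokesRegularity-15401, line `Sketch`. -/
theorem stub_rssProfileExists_of_profile :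
    (∃ (α C₀ M : ℝ) (U : EuclideanSpace ℝ (Fin 3) → EuclideanSpace ℝ (Fin 3))
      (P : EuclideanSpace ℝ (Fin 3) → ℝ), α ≠ 0 ∧ U ≠ 0 ∧ ContDiff ℝ (⊤ : ℕ∞) U ∧ ContDiff ℝ (⊤ : ℕ∞) P ∧
      VectorCalculus.IsDivFree U ∧
      (∀ y : EuclideanSpace ℝ (Fin 3), α • (rotGen (U y) - fderiv ℝ U y (rotGen y)) + (1 / 2 : ℝ) • U y +
        (1 / 2 : ℝ) • fderiv ℝ U y y - (Δ U) y + fderiv ℝ U y (U y) + gradient P y = 0) ∧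
      (∀ y : EuclideanSpace ℝ (Fin 3), ‖U y‖ ≤ C₀ / (1 + ‖y‖)) ∧
      (∀ y : EuclideanSpace ℝ (Fin 3), |P y| ≤ M)) →
    Summit.NavierStokesRegularity.NavierStokesRegularity.Theses.FilamentSkeletonRss.RssProfileExists := by
  rintro ⟨α, C₀, M, U, P, hα, hU0, hU, hP, hdiv, heq, hdec, hPM⟩
  obtain ⟨p, hcl, hp⟩ := stub_classicalOfProfile α M U P hU hP hdiv heq hPM
  exact stub_rssPackaging α C₀ U p hα (hU.of_le (by norm_cast)) hU0 hcl hp hdec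

end Summit.NavierStokesRegularity.NavierStokesRegularity.Theorems
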